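import Summits.CriticalPhenomena.PercolationContinuityZ3.Theorems.SahiMasterFamilyTerminalIff
import Summits.CriticalPhenomena.PercolationContinuityZ3.Theorems.SahiMasterFamilyTerminal
import Summits.CriticalPhenomena.PercolationContinuityZ3.Theorems.SahiMasterFamilyPCDBridge
import Summits.CriticalPhenomena.PercolationContinuityZ3.Theorems.SahiMasterFamilyComparableStep
import Summits.CriticalPhenomena.PercolationContinuityZ3.Theorems.SahiMasterFamilyShrunkFrameZeros
import Literature.Combinatorics.Sahi2008.Chains
import Literature.Combinatorics.Sahi2008.Symmetry

/-!
# (EQI-k) at every order from ONE combinatorial statement: terminal families are TIGHT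

Unit `prim-master-conj` (crux anchor stmt-CriticalPhenomena-4575), gen 9.  Seat document HOME/prim-master-conj/TIGHTNESS.md.

A family `U` of increasing events is TIGHT (principal-cap at the top) if its common part `⋂_j U_j` is a principal filter `{T : c ⊆ T}` —
equivalently every coordinate lies in the core (the intersection of the minimal sets) of some member, equivalently every `0`-minor of `U`
contains an EMPTY member.  On the principal-cap class the identically-zero master conjecture is a theorem at every order
(`SahiSparseEnd.sahiE_eq_zero_iff_suppZeroFlag_of_principalCap`, cell `prim-masterthm` P4: the sparse-end / PCD chain), and the tree's
`masterFamilyIdentEqIff_iff_terminal_all` (this unit, gen 7) reduces `MasterFamilyIdentEqIff (n+3)` to the non-vanishing of TERMINAL families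
(no zero-flag sub-family, no common pivotal coordinate, no private coordinate, all minors zero flags).  This file closes the gap between the two
modulo the purely combinatorial, measure-free statement

  **(TT_k) `TerminalTight`**: a terminal family of `k` increasing, non-empty, non-sure events none of which contains all the others is principal-cap,

which is CENSUS-EXACT (gen 9, seat engines `tightc.c`, `glue.c`; exhaustive over all families of non-trivial up-sets with full support on
`{0,1}^n`: `(n,k) ∈ {(2,3),(2,4),(3,3),(3,4),(3,5),(4,3),(4,4),(5,3),(5,4)}`, i.e. every terminal — indeed every FACE-VANISHING non-zero-flag — family
there is principal-cap except the OR-triangle `(x₀∨x₁, x₀∨x₂, x₁∨x₂)` and its extensions by the absorbing member `x₀∨x₁∨x₂`):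

* `sahiE_ind_eq_of_absorbing` — a member containing all the others factors off:
  `E_{n+2}(μ; 1_U) = ((n+1) − μ(U_j)) · E_{n+1}(μ; 1_{U_{−j}})` (Lieb–Sahi, tree `sahiE_of_head_absorbing`, moved to an arbitrary slot);
* `nonvanishing_terminal_of_terminalTight` — (EQI-(n+3)) and (TT_{n+4}) give the non-vanishing of every terminal family of order `n+4`
  (absorbing member: factor off and use (EQI-(n+3)) on the deleted family; otherwise (TT) + PCD);
* **`masterFamilyIdentEqIff_succ_of_terminalTight`**: `MasterFamilyIdentEqIff (n+3) → TerminalTight (n+1) → MasterFamilyIdentEqIff (n+4)`;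
* **`masterFamilyIdentEqIff_all_of_terminalTight`**: `(∀ n, TerminalTight (n+1)) → ∀ k, MasterFamilyIdentEqIff k` (orders `≤ 3` are tree
  theorems: `masterFamilyIdentEqIff_of_le_two`, `masterFamilyIdentEqIff_three`).
So the identically-zero master conjecture at every order is reduced to (TT_k), `k ≥ 4` — a statement about the recursive support class `Z_k`
alone, with no measure and no polynomial in it.  (TT_3) is false exactly at the OR-triangle, which is why the induction starts at the tree's
order-3 theorem.)  HONEST FRAMING: a reduction; (TT_k) is a conjecture (typed here, never used as a fact); `MasterFamilyIdentEqIff k` for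
`k ≥ 4`, the pointwise `MasterFamilyEqIff`, Sahi `C_k` / Kahn Conj. 5 remain OPEN. [this work]
-/

noncomputable section

open scoped Classical

namespace Summit.CriticalPhenomena.PercolationContinuityZ3.Theorems

open Finset Function
open Literature.Combinatorics.Sahi2008
open Literature.Probability.LatticeModels.Kahn2022 (Affects)
open Literature.Probability.Percolation (DeterminedBy)
open Literature.Probability.Percolation.DecisionTree (ind)

/-- **(TT_{n+3}) terminal families are tight** (OUR CONJECTURE for `n + 3 ≥ 4`; census-exact, see the module docstring; FALSE at order 3 exactly
at the OR-triangle): a family of `n+3` increasing, non-empty, non-sure events determined by `S`, with no zero-flag `(n+2)`-sub-family, no common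
pivotal coordinate, no private coordinate, all minors (`e ∈ S`) zero flags, and no member containing all the others, has a principal common part
`⋂_j U_j = {T : ↑c ⊆ T}`. [this work] [status: open for n+3 ≥ 4; census-exact n+3 = 4 on ≤ 5 coordinates, n+3 = 5 on ≤ 3] -/
@[conjecture] def TerminalTight (n : ℕ) : Prop :=
  ∀ (ι : Type) [Fintype ι] (U : Fin (n + 3) → Set (Set ι)) (S : Finset ι), (∀ j, IsUpperSet (U j)) →
    (∀ j, DeterminedBy (U j) (↑S : Set ι)) →
    (∀ j, (U j).Nonempty) → (∀ j, (∅ : Set ι) ∉ U j) →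
    (∀ m : Fin (n + 3), ¬ SuppZeroFlag (n + 2) (fun j => U (m.succAbove j))) →
    (¬ ∃ e : ι, ∀ j, ∃ ω, e ∉ ω ∧ ω ∉ U j ∧ insert e ω ∈ U j) →
    (¬ ∃ e : ι, ∃ c : Fin (n + 3), (∃ ω, e ∉ ω ∧ ω ∉ U c ∧ insert e ω ∈ U c) ∧ ∀ j, j ≠ c → ¬ Affects (U j) e) →
    (∀ e ∈ S, ∀ b : Bool, SuppZeroFlag (n + 3) (fun j => secAt e b (U j))) →
    (∀ j, ∃ l, l ≠ j ∧ ¬ U l ⊆ U j) →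
      ∃ c : Finset ι, ∀ T : Set ι, (∀ j, T ∈ U j) ↔ (↑c : Set ι) ⊆ T

variable {ι : Type} [Fintype ι]

/-! ### A member containing all the others factors off -/

/-- The permutation of `Fin (n+2)` sending `0 ↦ j` and `i+1 ↦ j.succAbove i`. [folklore] -/
def headTo {n : ℕ} (j : Fin (n + 2)) : Equiv.Perm (Fin (n + 2)) := (finSuccEquiv (n + 1)).trans (finSuccEquiv' j).symm

/-- `headTo j 0 = j`. [folklore] -/
theorem headTo_zero {n : ℕ} (j : Fin (n + 2)) : headTo j 0 = j := by
  simp [headTo]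

/-- `headTo j (i+1) = j.succAbove i`. [folklore] -/
theorem headTo_succ {n : ℕ} (j : Fin (n + 2)) (i : Fin (n + 1)) : headTo j i.succ = j.succAbove i := by
  simp [headTo]

/-- **Absorbing member, any slot.**  If `U_l ⊆ U_j` for every `l ≠ j` then
`E_{n+2}(μ; 1_U) = ((n+1) − μ(U_j)) · E_{n+1}(μ; 1_{U_{−j}})`. [cite: LiebSahi2021, Prop. 3.3 and Lemma 3.2 (arXiv p. 7)] -/
theorem sahiE_ind_eq_of_absorbing (μ : Set ι → ℝ) {n : ℕ} (U : Fin (n + 2) → Set (Set ι)) (j : Fin (n + 2))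
    (habs : ∀ l, l ≠ j → U l ⊆ U j) :
    sahiE μ (n + 2) (fun i => ind (U i)) =
      (((n : ℝ) + 1) - ex μ (ind (U j))) * sahiE μ (n + 1) (fun i => ind (U (j.succAbove i))) := by
  rw [← sahiE_comp_perm μ (n + 2) (headTo j) (fun i => ind (U i))]
  have hh : ∀ i : Fin (n + 1), (fun i => ind (U (headTo j i))) i.succ * (fun i => ind (U (headTo j i))) 0 =
      (fun i => ind (U (headTo j i))) i.succ := by
    intro i
    simp only [headTo_succ, headTo_zero]
    exact ind_mul_ind_eq_of_subset (habs _ (Fin.succAbove_ne j i))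
  rw [sahiE_of_head_absorbing μ n _ hh]
  have htail : Fin.tail (fun i => ind (U (headTo j i))) = fun i => ind (U (j.succAbove i)) :=
    funext fun i => by simp only [Fin.tail, headTo_succ]
  rw [htail, headTo_zero]

/-! ### Terminal families at order `n + 4` from (EQI-(n+3)) and (TT_{n+4}) -/

/-- **Non-vanishing of terminal families of order `n+4`** from the identically-zero master conjecture at order `n+3` and (TT_{n+4}):
a terminal family with a member containing all the others factors through its deleted family (not a zero flag, hence non-vanishing by
(EQI-(n+3))); a terminal family without one is principal-cap by (TT) and then non-vanishing by the PCD theorem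
(`SahiSparseEnd.sahiE_eq_zero_iff_suppZeroFlag_of_principalCap`). [this work] -/
theorem nonvanishing_terminal_of_terminalTight (n : ℕ) (hI : MasterFamilyIdentEqIff (n + 3)) (hT : TerminalTight (n + 1))
    (ι : Type) [Fintype ι] (U : Fin (n + 4) → Set (Set ι)) (S : Finset ι) (hU : ∀ j, IsUpperSet (U j))
    (hUS : ∀ j, DeterminedBy (U j) (↑S : Set ι))
    (hno : ∀ m : Fin (n + 4), ¬ SuppZeroFlag (n + 3) (fun j => U (m.succAbove j)))
    (hc : ¬ ∃ e : ι, ∀ j, ∃ ω, e ∉ ω ∧ ω ∉ U j ∧ insert e ω ∈ U j)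
    (hpriv : ¬ ∃ e : ι, ∃ c : Fin (n + 4), (∃ ω, e ∉ ω ∧ ω ∉ U c ∧ insert e ω ∈ U c) ∧ ∀ j, j ≠ c → ¬ Affects (U j) e)
    (hall : ∀ e ∈ S, ∀ b : Bool, SuppZeroFlag (n + 4) (fun j => secAt e b (U j))) :
    ∃ p : ι → unitInterval, (∀ i, (p i : ℝ) ∈ Set.Ioo (0 : ℝ) 1) ∧ sahiE (bernoulliWeight p) (n + 4) (fun j => ind (U j)) ≠ 0 := by
  by_cases habs : ∃ j, ∀ l, l ≠ j → U l ⊆ U j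
  · -- an absorbing member factors off; the deleted family is not a zero flag, hence non-vanishing by (EQI-(n+3))
    obtain ⟨j, hj⟩ := habs
    have hsub := hno j
    have hne : ¬ ∀ p : ι → unitInterval, (∀ e, (p e : ℝ) ∈ Set.Ioo (0 : ℝ) 1) →
        sahiE (bernoulliWeight p) (n + 3) (fun i => ind (U (j.succAbove i))) = 0 :=
      fun h => hsub ((hI ι (fun i => U (j.succAbove i)) (fun i => hU _)).1 h)
    push Not at hne
    obtain ⟨p, hp, hEne⟩ := hne
    refine ⟨p, hp, ?_⟩
    have e := sahiE_ind_eq_of_absorbing (bernoulliWeight p) (n := n + 2) U j hj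
    rw [e]
    refine mul_ne_zero (ne_of_gt ?_) hEne
    have h1 := ex_bernoulliWeight_ind_le_one p (U j)
    push_cast
    linarith
  · push Not at habs
    -- every member is non-empty (an empty member would put a sub-family into `Z_{n+3}`) and non-sure (a sure member absorbs)
    have hne : ∀ j, (U j).Nonempty := by
      intro j
      by_contra h
      rw [Set.not_nonempty_iff_eq_empty] at h
      obtain ⟨l, hl, -⟩ := habs j
      obtain ⟨m, hm⟩ := Fin.exists_succAbove_eq hl.symm
      exact hno l (suppZeroFlag_of_mem_empty (n + 2) (fun i => U (l.succAbove i)) m (by rw [hm]; exact h))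
    have h0 : ∀ j, (∅ : Set ι) ∉ U j := by
      intro j h
      obtain ⟨l, hl, hlj⟩ := habs j
      exact hlj fun T _ => hU j (Set.empty_subset T) h
    obtain ⟨c, hpc⟩ := hT ι U S hU hUS hne h0 hno hc hpriv hall habs
    have hZ : ¬ SuppZeroFlag (n + 4) U := by
      rintro ⟨m, hm, -⟩
      exact hno m hm
    have hiff := SahiSparseEnd.sahiE_eq_zero_iff_suppZeroFlag_of_principalCap U hU h0 c hpc
    have hnot : ¬ ∀ p : ι → unitInterval, (∀ e, (p e : ℝ) ∈ Set.Ioo (0 : ℝ) 1) →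
        sahiE (bernoulliWeight p) (n + 4) (fun j => ind (U j)) = 0 := fun h => hZ (hiff.1 h)
    push Not at hnot
    exact hnot

/-- **`MasterFamilyIdentEqIff (n+3) → TerminalTight (n+1) → MasterFamilyIdentEqIff (n+4)`.** [this work] -/
theorem masterFamilyIdentEqIff_succ_of_terminalTight (n : ℕ) (hI : MasterFamilyIdentEqIff (n + 3)) (hT : TerminalTight (n + 1)) :
    MasterFamilyIdentEqIff (n + 4) :=
  (masterFamilyIdentEqIff_iff_terminal_all (n + 1)).2
    (fun ι _ U S hU hUS hno hc hpriv hall => nonvanishing_terminal_of_terminalTight n hI hT ι U S hU hUS hno hc hpriv hall)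

/-- **The identically-zero master conjecture at EVERY order from (TT_k), `k ≥ 4`.**  Orders `≤ 2` and `3` are tree theorems; the rest is the
induction `masterFamilyIdentEqIff_succ_of_terminalTight`. [this work] -/
theorem masterFamilyIdentEqIff_all_of_terminalTight (hT : ∀ n, TerminalTight (n + 1)) : ∀ k, MasterFamilyIdentEqIff k := by
  have h3 : ∀ n, MasterFamilyIdentEqIff (n + 3) := by
    intro n
    induction n with
    | zero => exact masterFamilyIdentEqIff_three
    | succ n ih => exact masterFamilyIdentEqIff_succ_of_terminalTight n ih (hT n)
  intro k
  rcases Nat.lt_or_ge k 3 with hk | hk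
  · exact masterFamilyIdentEqIff_of_le_two (by omega)
  · obtain ⟨n, rfl⟩ := Nat.exists_eq_add_of_le' hk
    exact h3 n

/-- **Order four**: (EQI-4) follows from (TT_4) alone. [this work] -/
theorem masterFamilyIdentEqIff_four_of_terminalTight (hT : TerminalTight 1) : MasterFamilyIdentEqIff 4 :=
  masterFamilyIdentEqIff_succ_of_terminalTight 0 masterFamilyIdentEqIff_three hT

end Summit.CriticalPhenomena.PercolationContinuityZ3.Theorems
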